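import Summits.ResolutionOfSingularities.ResolutionOfSingularities.Theorems.WeightedInvariantIota3Sigma
import HarnessLib

/-!
# ASCENT of the flag-slope letters `σ` along flat local homomorphisms with `𝔪S′ = 𝔪′` (ORDER (o39) «σ ASCENDS»)

Route `ResolutionOfSingularities/WeightedInvariant`, crux `Theses.WeightedInvariant.HypersurfaceCentreConstruction`
(stmt-ResolutionOfSingularities-19897), door line `local-engine`, KEY `stub_localWeightedDropEFT4S`, P3 rung `stub_keyRung_dimLEThree`;
IOTA3-DESIGN v1.2 §2.3, clauses (c10σ|νε)/(c11σ|νε) — their ASCENT halves (res-L1-w43-plan-1 DEALS gen 11 #1 (5), ORDER (o39) to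
res-type-057), over res-type-073's typed letters `…Iota3Sigma` (p528355): `flagContactFiltration`, `IsTwoFlag`, `FlagReaches`,
`sigmaRatioNat`, `levelSet`/`sigmaLevelNat`, `iotaSigmaRatio`/`iotaSigmaLevel`/`iotaSigma`.

THE CLASS OF MAPS (stated exactly as proved): an algebra `S → S′` of LOCAL rings (for the filtration: any; for flags, reached
weights and the letters: `Module.Flat S S′`) with **`(𝔪_S)·S′ = 𝔪_{S′}`** (`hm`).  It contains: the localisation `S → S[X]_{𝔪S[X]}` at the
generic point of the closed fibre (the map behind (c10) `IotaTorusFactorMonotone`), essentially smooth / étale local maps with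
trivial relative dimension, residue-field extensions `S → S ⊗ k′` localised, completions.  `hm` makes the map local
(`isLocalHom_of_map_maximalIdeal_eq`), flat + local makes it FAITHFULLY flat, so every ideal is contracted from its extension
(Mathlib `Module.FaithfullyFlat.of_flat_of_isLocalHom` + `Ideal.comap_map_eq_self_of_faithfullyFlat`, used inside `mem_iff_algebraMap_mem_map_of_flat`; the tree's `EssSmoothDescent.comap_map_eq` is the same fact for the ess-smooth class) — the one tool used throughout.

RESULTS (ASCENT = «nothing reached downstairs is lost upstairs»):
* `map_flagContactFiltration_le` (any local map with `𝔪S′ ⊆ 𝔪′`) and **`map_flagContactFiltration_eq`** (`𝔪S′ = 𝔪′`): the two-flag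
  filtration EXTENDS to the two-flag filtration of the images — `(F_{g₁,g₂}^{(q;r₁,r₂)}(n))·S′ = F_{φg₁,φg₂}^{(q;r₁,r₂)}(n)`;
* `mem_maximalIdeal_pow_iff_of_flat`, **`adicOrder_algebraMap_eq_of_flat`** (`ν` is preserved);
* **`IsTwoFlag.algebraMap_of_flat`** — flags ascend (faithful flatness: `g₁ ∈ (g₂) + 𝔪²` would descend);
* **`FlagReaches.algebraMap_of_flat`** — reached weights ascend; hence the RATIO witnesses ascend (`sigmaRatio_witness_algebraMap`)
  and, at a ratio tie, the LEVEL set ascends (`levelSet_subset_of_flat`);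
* the letters do not decrease: `sigmaRatioNat_le_of_flat` / `iotaSigmaRatio_le_of_flat` (under boundedness of the upstairs ratio
  witnesses — `Nat.sSup` junk otherwise), `sigmaLevelNat_le_of_flat`, `iotaSigmaLevel_le_of_flat`, **`iotaSigma_le_of_flat`**
  (the monotone half of (c10σ)/(c11σ), with the two junk-corner hypotheses spelled out);
* DESCENT is NOT proved here (it is the open half: «no flag upstairs reaches further»); `…_of_descent` lemmas record that WITH
  descent as a hypothesis everything is an EQUALITY (`sigmaRatioNat_algebraMap_eq_of_descent`, `levelSet_algebraMap_eq_of_descent`,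
  `iotaSigma_algebraMap_eq_of_descent`) — i.e. (c11σ) for this class of maps reduces to DESCENT alone.

Def-free helper (`--supports stmt-ResolutionOfSingularities-19897`); OURS bookkeeping on candidate letters of OUR key statement; nothing
here is a statement of the manuscript under review or a claim about resolution of singularities in positive characteristic.  AI-written;
weaker than expert review.  [OURS · L1 W4.3 · (o39)]
[cite: Matsumura1987, Thm. 7.5 (faithful flatness of flat local homomorphisms) and §8] [cite: CossartJannsenSaito2020, Lemma 2.27 (1)]
-/

noncomputable section

set_option linter.dupNamespace false -- mandated namespace of this single-conjunct summit

open IsLocalRing Literature.AlgebraicGeometry.Resolution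
open Summit.ResolutionOfSingularities.ResolutionOfSingularities.Theorems

namespace Summit.ResolutionOfSingularities.ResolutionOfSingularities.Cruxes.HypersurfaceCentreConstruction.LocalEngine

namespace Iota3

universe u

/-! ## §1 The two-flag filtration along a local map -/

section Map

variable {S S' : Type u} [CommRing S] [CommRing S'] [IsLocalRing S] [IsLocalRing S'] (φ : S →+* S')

/-- Along a ring homomorphism with `φ(𝔪) ⊆ 𝔪′` the image of the two-flag filtration of `(g₁, g₂)` lies in the two-flag filtration of
`(φ g₁, φ g₂)` (same weights, same degree). [folklore] -/
theorem map_flagContactFiltration_le (hφ : (maximalIdeal S).map φ ≤ maximalIdeal S') (g₁ g₂ : S) (q r₁ r₂ n : ℕ) :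
    (flagContactFiltration g₁ g₂ q r₁ r₂ n).map φ ≤ flagContactFiltration (φ g₁) (φ g₂) q r₁ r₂ n := by
  rw [flagContactFiltration_def, flagContactFiltration_def, Ideal.map_iSup]
  refine iSup_mono fun α => ?_
  rw [Ideal.map_iSup]
  refine iSup_mono fun β => ?_
  rw [Ideal.map_mul, Ideal.map_pow, Ideal.map_span, Set.image_singleton, map_mul, map_pow, map_pow]
  exact Ideal.mul_mono_right (Ideal.pow_right_mono hφ _)

/-- **With `φ(𝔪)·S′ = 𝔪′` the two-flag filtration EXTENDS to the two-flag filtration of the images**: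
`(flagContactFiltration g₁ g₂ q r₁ r₂ n)·S′ = flagContactFiltration (φ g₁) (φ g₂) q r₁ r₂ n`. [folklore] -/
theorem map_flagContactFiltration_eq (hm : (maximalIdeal S).map φ = maximalIdeal S') (g₁ g₂ : S) (q r₁ r₂ n : ℕ) :
    (flagContactFiltration g₁ g₂ q r₁ r₂ n).map φ = flagContactFiltration (φ g₁) (φ g₂) q r₁ r₂ n := by
  rw [flagContactFiltration_def, flagContactFiltration_def, Ideal.map_iSup]
  refine iSup_congr fun α => ?_
  rw [Ideal.map_iSup]
  refine iSup_congr fun β => ?_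
  rw [Ideal.map_mul, Ideal.map_pow, Ideal.map_span, Set.image_singleton, map_mul, map_pow, map_pow, hm]

/-- Membership form of `map_flagContactFiltration_le`. [folklore] -/
theorem map_mem_flagContactFiltration (hφ : (maximalIdeal S).map φ ≤ maximalIdeal S') {f g₁ g₂ : S} {q r₁ r₂ n : ℕ}
    (hf : f ∈ flagContactFiltration g₁ g₂ q r₁ r₂ n) : φ f ∈ flagContactFiltration (φ g₁) (φ g₂) q r₁ r₂ n :=
  map_flagContactFiltration_le φ hφ g₁ g₂ q r₁ r₂ n (Ideal.mem_map_of_mem φ hf)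

end Map

/-! ## §2 Flat algebras of local rings with `𝔪S′ = 𝔪′`: faithful flatness and the order -/

section Flat

variable {S S' : Type u} [CommRing S] [CommRing S'] [IsLocalRing S] [IsLocalRing S'] [Algebra S S'] [Module.Flat S S']
  (hm : (maximalIdeal S).map (algebraMap S S') = maximalIdeal S')

include hm

omit [Module.Flat S S'] in
/-- `𝔪S′ = 𝔪′` (indeed `⊆`) makes the structure map local. [folklore] -/
theorem isLocalHom_of_map_maximalIdeal_eq : IsLocalHom (algebraMap S S') :=
  ((IsLocalRing.local_hom_TFAE (algebraMap S S')).out 0 2).mpr hm.le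

/-- Membership is detected upstairs. [folklore] -/
theorem mem_iff_algebraMap_mem_map_of_flat (I : Ideal S) (f : S) : f ∈ I ↔ algebraMap S S' f ∈ I.map (algebraMap S S') := by
  -- flat + local ⇒ faithfully flat ⇒ `I S′ ∩ S = I` (Mathlib; cf. `EssSmoothDescent.comap_map_eq` for the ess-smooth class)
  haveI := isLocalHom_of_map_maximalIdeal_eq hm
  haveI : Module.FaithfullyFlat S S' := Module.FaithfullyFlat.of_flat_of_isLocalHom
  rw [← Ideal.mem_comap, Ideal.comap_map_eq_self_of_faithfullyFlat]

/-- `f ∈ 𝔪ⁿ ↔ f ∈ 𝔪′ⁿ` upstairs. [folklore] -/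
theorem mem_maximalIdeal_pow_iff_of_flat (f : S) (n : ℕ) :
    f ∈ maximalIdeal S ^ n ↔ algebraMap S S' f ∈ maximalIdeal S' ^ n := by
  rw [mem_iff_algebraMap_mem_map_of_flat hm (maximalIdeal S ^ n), Ideal.map_pow, hm]

/-- **The order is preserved**: `adicOrder (f·1_{S′}) = adicOrder f`. [folklore] -/
theorem adicOrder_algebraMap_eq_of_flat (f : S) : adicOrder (algebraMap S S' f) = adicOrder f :=
  ENat.eq_of_forall_natCast_le_iff fun n => by
    rw [le_adicOrder_iff, le_adicOrder_iff, mem_maximalIdeal_pow_iff_of_flat hm]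

/-! ## §3 Flags and reached weights ascend -/

/-- **Two-flags ascend**: if `(g₁, g₂)` have independent residues in `𝔪/𝔪²` then so do their images in `𝔪′/𝔪′²`.  (If, say,
`a·φg₁ + b·φg₂ ∈ 𝔪′²` with `a` a unit, then `φ g₁ ∈ (φ g₂) + 𝔪′² = ((g₂) + 𝔪²)·S′`, so `g₁ ∈ (g₂) + 𝔪²` by faithful flatness —
contradicting the flag downstairs.) [folklore] -/
theorem IsTwoFlag.algebraMap_of_flat {g₁ g₂ : S} (h : IsTwoFlag g₁ g₂) :
    IsTwoFlag (algebraMap S S' g₁) (algebraMap S S' g₂) := by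
  -- the descent step, symmetric in the two members
  have key : ∀ {x y : S}, (∀ c : S, x + c * y ∈ maximalIdeal S ^ 2 → False) →
      ∀ a b : S', IsUnit a → a * algebraMap S S' x + b * algebraMap S S' y ∈ maximalIdeal S' ^ 2 → False := by
    intro x y hxy a b ha hab
    obtain ⟨u, rfl⟩ := ha
    have hx : algebraMap S S' x ∈ (Ideal.span {y} ⊔ maximalIdeal S ^ 2).map (algebraMap S S') := by
      rw [Ideal.map_sup, Ideal.map_span, Set.image_singleton, Ideal.map_pow, hm, Ideal.mem_span_singleton_sup]
      refine ⟨-(↑u⁻¹ * b), ↑u⁻¹ * (↑u * algebraMap S S' x + b * algebraMap S S' y), Ideal.mul_mem_left _ _ hab, ?_⟩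
      rw [mul_add, ← mul_assoc, Units.inv_mul, one_mul]
      ring
    rw [← mem_iff_algebraMap_mem_map_of_flat hm, Ideal.mem_span_singleton_sup] at hx
    obtain ⟨c, m, hm2, hcm⟩ := hx
    exact hxy (-c) (by rw [← hcm]; ring_nf; exact hm2)
  refine ⟨hm.le (Ideal.mem_map_of_mem _ h.1), hm.le (Ideal.mem_map_of_mem _ h.2.1), fun a b hab => ?_⟩
  have h1 : ∀ c : S, g₁ + c * g₂ ∈ maximalIdeal S ^ 2 → False := fun c hc => by
    have := (h.2.2 1 c (by rwa [one_mul])).1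
    exact (IsLocalRing.maximalIdeal.isMaximal S).ne_top (Ideal.eq_top_of_isUnit_mem _ this isUnit_one)
  have h2 : ∀ c : S, g₂ + c * g₁ ∈ maximalIdeal S ^ 2 → False := fun c hc => by
    have := (h.2.2 c 1 (by rwa [one_mul, add_comm])).2
    exact (IsLocalRing.maximalIdeal.isMaximal S).ne_top (Ideal.eq_top_of_isUnit_mem _ this isUnit_one)
  constructor
  · by_contra ha
    exact key h1 a b ((IsLocalRing.mem_maximalIdeal a).not.mp ha |> not_not.mp) hab
  · by_contra hb
    exact key h2 b a ((IsLocalRing.mem_maximalIdeal b).not.mp hb |> not_not.mp) (by rwa [add_comm])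

/-- **Reached weights ascend**: `FlagReaches f ν q r₁ r₂ → FlagReaches (f·1_{S′}) ν q r₁ r₂` (same flag, pushed forward).
[folklore] -/
theorem FlagReaches.algebraMap_of_flat {f : S} {ν q r₁ r₂ : ℕ} (h : FlagReaches f ν q r₁ r₂) :
    FlagReaches (algebraMap S S' f) ν q r₁ r₂ := by
  obtain ⟨g₁, g₂, hfl, hmem⟩ := h
  exact ⟨_, _, hfl.algebraMap_of_flat hm, map_mem_flagContactFiltration (algebraMap S S') hm.le hmem⟩

/-! ## §4 The letters do not decrease -/

/-- The RATIO witnesses ascend: every scaled ratio `m` witnessed downstairs is witnessed upstairs (same triple, same flag; the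
order is preserved). [folklore] -/
theorem sigmaRatio_witness_algebraMap (f : S) :
    {m : ℕ | ∃ q r₁ r₂ : ℕ, AdmissibleTriple q r₁ r₂ ∧ FlagReaches f (adicOrder f).toNat q r₁ r₂ ∧
        m * r₂ ≤ ratioScale (adicOrder f).toNat * r₁} ⊆
      {m : ℕ | ∃ q r₁ r₂ : ℕ, AdmissibleTriple q r₁ r₂ ∧
        FlagReaches (algebraMap S S' f) (adicOrder (algebraMap S S' f)).toNat q r₁ r₂ ∧
        m * r₂ ≤ ratioScale (adicOrder (algebraMap S S' f)).toNat * r₁} := by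
  rintro m ⟨q, r₁, r₂, hadm, hreach, hle⟩
  rw [Set.mem_setOf_eq, adicOrder_algebraMap_eq_of_flat hm]
  exact ⟨q, r₁, r₂, hadm, hreach.algebraMap_of_flat hm, hle⟩

/-- **`σ₁` does not decrease** (provided the upstairs witness set is bounded — `Nat.sSup` is junk `0` on unbounded sets).
[folklore] -/
theorem sigmaRatioNat_le_of_flat (f : S)
    (hbdd : BddAbove {m : ℕ | ∃ q r₁ r₂ : ℕ, AdmissibleTriple q r₁ r₂ ∧
        FlagReaches (algebraMap S S' f) (adicOrder (algebraMap S S' f)).toNat q r₁ r₂ ∧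
        m * r₂ ≤ ratioScale (adicOrder (algebraMap S S' f)).toNat * r₁}) :
    sigmaRatioNat f ≤ sigmaRatioNat (algebraMap S S' f) := by
  unfold sigmaRatioNat
  by_cases hne : {m : ℕ | ∃ q r₁ r₂ : ℕ, AdmissibleTriple q r₁ r₂ ∧ FlagReaches f (adicOrder f).toNat q r₁ r₂ ∧
      m * r₂ ≤ ratioScale (adicOrder f).toNat * r₁}.Nonempty
  · exact csSup_le_csSup hbdd hne (sigmaRatio_witness_algebraMap hm f)
  · rw [Set.not_nonempty_iff_eq_empty.mp hne, csSup_empty]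
    exact bot_le

/-- At a RATIO TIE the level set ascends. [folklore] -/
theorem levelSet_subset_of_flat (f : S) (htie : sigmaRatioNat (algebraMap S S' f) = sigmaRatioNat f) :
    levelSet f ⊆ levelSet (algebraMap S S' f) := by
  rintro m ⟨q, r₁, r₂, hadm, hreach, hratio, hle⟩
  refine ⟨q, r₁, r₂, hadm, ?_, ?_, ?_⟩
  · rw [adicOrder_algebraMap_eq_of_flat hm]; exact hreach.algebraMap_of_flat hm
  · rw [adicOrder_algebraMap_eq_of_flat hm, htie]; exact hratio
  · rw [adicOrder_algebraMap_eq_of_flat hm, htie]; exact hle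

/-- **`σ₂` (finite part) does not decrease at a ratio tie** (upstairs level set bounded). [folklore] -/
theorem sigmaLevelNat_le_of_flat (f : S) (htie : sigmaRatioNat (algebraMap S S' f) = sigmaRatioNat f)
    (hbdd : BddAbove (levelSet (algebraMap S S' f))) : sigmaLevelNat f ≤ sigmaLevelNat (algebraMap S S' f) := by
  unfold sigmaLevelNat
  by_cases hne : (levelSet f).Nonempty
  · exact csSup_le_csSup hbdd hne (levelSet_subset_of_flat hm f htie)
  · rw [Set.not_nonempty_iff_eq_empty.mp hne, csSup_empty]
    exact bot_le

/-! ## §5 With DESCENT as a hypothesis: equalities -/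

/-- Descent of reached weights (the OPEN half, taken as a hypothesis) makes `FlagReaches` an `iff`. [folklore] -/
theorem flagReaches_algebraMap_iff_of_descent {f : S}
    (hdesc : ∀ ν q r₁ r₂ : ℕ, FlagReaches (algebraMap S S' f) ν q r₁ r₂ → FlagReaches f ν q r₁ r₂) (ν q r₁ r₂ : ℕ) :
    FlagReaches (algebraMap S S' f) ν q r₁ r₂ ↔ FlagReaches f ν q r₁ r₂ :=
  ⟨hdesc ν q r₁ r₂, fun h => h.algebraMap_of_flat hm⟩

/-- With descent, `σ₁` is preserved. [folklore] -/
theorem sigmaRatioNat_algebraMap_eq_of_descent {f : S}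
    (hdesc : ∀ ν q r₁ r₂ : ℕ, FlagReaches (algebraMap S S' f) ν q r₁ r₂ → FlagReaches f ν q r₁ r₂) :
    sigmaRatioNat (algebraMap S S' f) = sigmaRatioNat f := by
  simp only [sigmaRatioNat, adicOrder_algebraMap_eq_of_flat hm, flagReaches_algebraMap_iff_of_descent hm hdesc]

/-- With descent, the level set is preserved. [folklore] -/
theorem levelSet_algebraMap_eq_of_descent {f : S}
    (hdesc : ∀ ν q r₁ r₂ : ℕ, FlagReaches (algebraMap S S' f) ν q r₁ r₂ → FlagReaches f ν q r₁ r₂) :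
    levelSet (algebraMap S S' f) = levelSet f := by
  simp only [levelSet, adicOrder_algebraMap_eq_of_flat hm, flagReaches_algebraMap_iff_of_descent hm hdesc,
    sigmaRatioNat_algebraMap_eq_of_descent hm hdesc]

/-- With descent, `σ₂` (finite part) is preserved. [folklore] -/
theorem sigmaLevelNat_algebraMap_eq_of_descent {f : S}
    (hdesc : ∀ ν q r₁ r₂ : ℕ, FlagReaches (algebraMap S S' f) ν q r₁ r₂ → FlagReaches f ν q r₁ r₂) :
    sigmaLevelNat (algebraMap S S' f) = sigmaLevelNat f := by
  rw [sigmaLevelNat, sigmaLevelNat, levelSet_algebraMap_eq_of_descent hm hdesc]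

end Flat

/-! ## §6 The ordinal letters (`Type`-valued carriers, as the clause vocabulary) -/

section Ordinal

variable {S S' : Type} [CommRing S] [CommRing S'] [IsLocalRing S] [IsLocalRing S'] [Algebra S S'] [Module.Flat S S']
  (hm : (maximalIdeal S).map (algebraMap S S') = maximalIdeal S')

include hm

/-- `iotaSigmaRatio` does not decrease (upstairs ratio witnesses bounded). [folklore] -/
theorem iotaSigmaRatio_le_of_flat (f : S)
    (hbdd : BddAbove {m : ℕ | ∃ q r₁ r₂ : ℕ, AdmissibleTriple q r₁ r₂ ∧
        FlagReaches (algebraMap S S' f) (adicOrder (algebraMap S S' f)).toNat q r₁ r₂ ∧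
        m * r₂ ≤ ratioScale (adicOrder (algebraMap S S' f)).toNat * r₁}) :
    iotaSigmaRatio S f ≤ iotaSigmaRatio S' (algebraMap S S' f) := by
  rw [iotaSigmaRatio_eq, iotaSigmaRatio_eq]
  exact_mod_cast sigmaRatioNat_le_of_flat hm f hbdd

/-- `iotaSigmaLevel` does not decrease at a ratio tie, outside ONE junk corner: if the upstairs level set is bounded and
non-empty then the downstairs one must be non-empty (automatic under DESCENT). [folklore] -/
theorem iotaSigmaLevel_le_of_flat (f : S) (htie : sigmaRatioNat (algebraMap S S' f) = sigmaRatioNat f)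
    (hcorner : BddAbove (levelSet (algebraMap S S' f)) ∧ (levelSet (algebraMap S S' f)).Nonempty → (levelSet f).Nonempty) :
    iotaSigmaLevel S f ≤ iotaSigmaLevel S' (algebraMap S S' f) := by
  by_cases hb' : BddAbove (levelSet (algebraMap S S' f)) ∧ (levelSet (algebraMap S S' f)).Nonempty
  · have hb : BddAbove (levelSet f) ∧ (levelSet f).Nonempty :=
      ⟨hb'.1.mono (levelSet_subset_of_flat hm f htie), hcorner hb'⟩
    rw [iotaSigmaLevel_eq S f hb, iotaSigmaLevel_eq S' _ hb']
    exact_mod_cast sigmaLevelNat_le_of_flat hm f htie hb'.1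
  · rw [iotaSigmaLevel_eq_omega0 S' _ hb']
    exact iotaSigmaLevel_le_omega0 S f

/-- **`σ` DOES NOT DECREASE along a flat algebra of local rings with `𝔪S′ = 𝔪′`** — the monotone (ASCENT) half of
(c10σ)/(c11σ) for this class of maps, with the two `Nat.sSup` junk corners as hypotheses (both hold under DESCENT). [folklore] -/
theorem iotaSigma_le_of_flat (f : S)
    (hbdd : BddAbove {m : ℕ | ∃ q r₁ r₂ : ℕ, AdmissibleTriple q r₁ r₂ ∧
        FlagReaches (algebraMap S S' f) (adicOrder (algebraMap S S' f)).toNat q r₁ r₂ ∧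
        m * r₂ ≤ ratioScale (adicOrder (algebraMap S S' f)).toNat * r₁})
    (hcorner : sigmaRatioNat (algebraMap S S' f) = sigmaRatioNat f →
      BddAbove (levelSet (algebraMap S S' f)) ∧ (levelSet (algebraMap S S' f)).Nonempty → (levelSet f).Nonempty) :
    iotaSigma S f ≤ iotaSigma S' (algebraMap S S' f) := by
  refine iotaLex_le_of iotaSigmaLevel_boundedBy (iotaSigmaRatio_le_of_flat hm f hbdd) fun heq => ?_
  have htie : sigmaRatioNat (algebraMap S S' f) = sigmaRatioNat f := by
    rw [iotaSigmaRatio_eq, iotaSigmaRatio_eq] at heq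
    exact_mod_cast heq.symm
  exact iotaSigmaLevel_le_of_flat hm f htie (hcorner htie)

/-- **With DESCENT, `σ` is PRESERVED** (`iotaSigma S′ (f·1) = iotaSigma S f`): for this class of maps (c11σ) reduces to the
descent of reached weights. [folklore] -/
theorem iotaSigma_algebraMap_eq_of_descent {f : S}
    (hdesc : ∀ ν q r₁ r₂ : ℕ, FlagReaches (algebraMap S S' f) ν q r₁ r₂ → FlagReaches f ν q r₁ r₂) :
    iotaSigma S' (algebraMap S S' f) = iotaSigma S f := by
  have h1 : iotaSigmaRatio S' (algebraMap S S' f) = iotaSigmaRatio S f := by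
    rw [iotaSigmaRatio_eq, iotaSigmaRatio_eq, sigmaRatioNat_algebraMap_eq_of_descent hm hdesc]
  have h2 : iotaSigmaLevel S' (algebraMap S S' f) = iotaSigmaLevel S f := by
    have hL := levelSet_algebraMap_eq_of_descent hm hdesc (f := f)
    by_cases hb : BddAbove (levelSet f) ∧ (levelSet f).Nonempty
    · rw [iotaSigmaLevel_eq S f hb, iotaSigmaLevel_eq S' _ (by rw [hL]; exact hb),
        sigmaLevelNat_algebraMap_eq_of_descent hm hdesc]
    · rw [iotaSigmaLevel_eq_omega0 S f hb, iotaSigmaLevel_eq_omega0 S' _ (by rw [hL]; exact hb)]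
  unfold iotaSigma
  exact (iotaLex_eq_iff iotaSigmaLevel_boundedBy S' (algebraMap S S' f) S f).mpr ⟨h1, h2⟩

end Ordinal

end Iota3

end Summit.ResolutionOfSingularities.ResolutionOfSingularities.Cruxes.HypersurfaceCentreConstruction.LocalEngine

end
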